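import Summits.Ventures.YMGap.RobustBall.TorusClustering
import Summits.Ventures.YMGap.RobustBall.RobustMassGapDoor
import Summits.QuantumFields.BalabanUV.InfraRed.StrongCouplingPoincareDoorSUN
import HarnessLib

/-!
# Venture YMGap, track ROBUST-BALL (Y2) — the robust TORUS door in VARIANCE form (Poincaré × variance pair,
rb-p1's lineage on the torus) and its clustering currencies

HONEST FRAMING. WHAT THIS IS: a venture file (cell `pub-ymgap`, track Y2 ROBUST-BALL, seat ds-2): a SECOND
instantiation of the robust torus Dobrushin door, through rb-p1's robust one-link lemma in variance form
(`abs_integral_perturbedOneLink_sub_le`, Holley–Stroock factor `e^{a}` on a Poincaré × variance modulus, NO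
self-Lipschitz load) instead of ds-4's transfer of a black-box KR modulus (`TorusDoor`). For a one-link Poincaré /
variance pair `OneLinkPoincareSUN N b c`, `OneLinkVarianceBound N b v` (the tree's HYPOTHESIS SCHEMAS, by name) on the
radius `b ≥ (|β|/N) 2(d−1)` of the torus link fields at tree coupling `β`, the perturbed torus specification of a member
`W` with load witness `w` is a KR contraction with the matrix
`C_V(e,y) = e^{a(e)} √(c v) (|β|/N) n(e,y) + e^{a(e)/2} √c ℓ(e,y)`, rows `≤ e^{a}√(cv)(|β|/N)6(d−1) + e^{a/2}√c Λ(e)`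
(weighted by `e^{t‖e−y‖_∞}`: factor `e^{t}` on the Wilson part, `Λ_t` on the cross part); hence the doors
`RobustTorusDoor N d β ε₀ ε₁ r ρ_V` and `RobustTorusDoorW N d β κ ε₀ ε₁ κ (e^{κ}-version)` with
`ρ_V = e^{ε₀} √(c v) (|β|/N) 6(d−1) + e^{ε₀/2} √c ε₁`, and by `TorusClustering` the clustering currencies
`TorusClusteringOnBall … (8N) (−log ρ_V/(r ⊔ 1))`, `TorusClusteringOnBallW … (8N) κ`. For `SU(2)` the pair
`(c, v) = (2/3, 2)` is a TREE THEOREM up to Wilson `β_W ≤ 1/5` (`oneLinkPoincareSUN_two_sharp`, engine-2's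
`oneLinkVarianceBound_two_of_le_fifth`): rows in `TorusRowsSU2Variance`.
WHAT THIS IS NOT: no new one-link analysis (rb-p1's lemma verbatim), no `ℤ^d` statement, no number here; lattice
strong-coupling bookkeeping on finite tori — no continuum, no Millennium claim.

## References
* R. Holley, D. Stroock, J. Stat. Phys. 46 (1987) 1159; H. Föllmer, LNM 1362 (1988) Ch. I (2.7)–(2.24).
* The tree: rb-p1's `RobustBall/RobustOneLink.lean`, `RobustBall/RobustMassGapDoor.lean` (the `ℤ^d` twin,
  `exists_window_of_osc`), `StrongCouplingPoincareDoorSUN.lean` / `StrongCouplingVarianceDoorSUN.lean` (the schemas).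
-/

noncomputable section

open MeasureTheory ProbabilityTheory Finset Function Real
open Literature.Probability.LatticeModels Literature.Probability.LatticeModels.DobrushinMetric
open Literature.MathematicalPhysics.QuantumLattice hiding torusNorm
open Literature.MathematicalPhysics.QuantumFieldTheory hiding ZdEdge
open Literature.MathematicalPhysics.QuantumFieldTheory.Balaban1983to89.StrongCouplingTorusWindow
open Summit.QuantumFields.BalabanUV.InfraRed.StrongCouplingPoincareDoorSUN (OneLinkPoincareSUN)
open Summit.QuantumFields.BalabanUV.InfraRed.StrongCouplingVarianceDoorSUN (OneLinkVarianceBound)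

namespace Summit.Ventures.YMGap.RobustBall

variable {d L N : ℕ} [NeZero L]

/-! ### The variance-form entry -/

section Entry

variable {W : Perturbation d L N}

/-- The one-link law of the member as ONE tilt of Haar: `σ_N.tilted (N Re tr(g B_ω) − h_{W,e,ω}(g))` (U0 with the two
tilts merged, the form of rb-p1's one-link lemma). [folklore] -/
theorem siteLaw_perturbedTorusSpec_thooft_sub (β : ℝ) (hL : 1 < L) (hN : 1 ≤ N) (e : Edge d L)
    (ω : GaugeConfig d L (SUN N)) :
    siteLaw (perturbedTorusSpec W β) e ω =
      (haarProbability (SUN N)).tilted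
        fun g => (N : ℝ) * ((g : Matrix (Fin N) (Fin N) ℂ) * tField β e ω).trace.re - localTilt W e ω g := by
  rw [siteLaw_perturbedTorusSpec_thooft W β hL hN e ω,
    ← OneLinkTiltStability.su_tilted_linear_add (tField β e ω) (fun g => -localTilt W e ω g)]
  rfl

/-- **The robust Dobrushin entry, variance form.** For `ω = η` off `y ≠ e`, a Poincaré / variance pair `(c, v)` on the
radius `b ≥ (|β|/N) 2(d−1)` and a bounded measurable `Lφ`-Lipschitz `φ`:
`|γ_e(φ|ω) − γ_e(φ|η)| ≤ (e^{a(e)} √(cv) (|β|/N) n(e,y) + e^{a(e)/2} √c ℓ(e,y)) · Lφ · ‖ω_y − η_y‖_F` — rb-p1's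
`abs_integral_perturbedOneLink_sub_le` at the torus link fields with the window `lo ≤ h ≤ lo + a(e)`
(`exists_window_of_osc` from the oscillation load) and the cross bound `|h_ω − h_η| ≤ ℓ(e,y)‖ω_y − η_y‖_F`. [folklore] -/
theorem abs_integral_siteLaw_sub_le_variance (hd : 1 ≤ d) (hN : 1 ≤ N) (hL : 1 < L) {β b c v : ℝ} (hc : 0 ≤ c)
    (hv : 0 ≤ v) (hb : |β| / N * (2 * ((d : ℝ) - 1)) ≤ b) (hP : OneLinkPoincareSUN N b c)
    (hVB : OneLinkVarianceBound N b v) (w : LoadWitness W) {e y : Edge d L} (hye : y ≠ e)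
    {ω η : GaugeConfig d L (SUN N)} (hωη : ∀ z, z ≠ y → ω z = η z) (φ : SUN N → ℝ) (Lφ : ℝ)
    (hφm : Measurable φ) (hφb : ∃ M, ∀ s, |φ s| ≤ M) (hLφ : 0 ≤ Lφ) (hφL : ∀ a b, |φ a - φ b| ≤ Lφ * suFrobDist a b) :
    |∫ s, φ s ∂(siteLaw (perturbedTorusSpec W β) e ω) - ∫ s, φ s ∂(siteLaw (perturbedTorusSpec W β) e η)| ≤
      (Real.exp (w.oscLoad 0 e) * Real.sqrt (c * v) * (|β| / N) * tInfluence e y +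
        Real.exp (w.oscLoad 0 e / 2) * Real.sqrt c * w.crossLip 0 e y) * Lφ * suFrobDist (ω y) (η y) := by
  rw [siteLaw_perturbedTorusSpec_thooft_sub β hL hN e ω, siteLaw_perturbedTorusSpec_thooft_sub β hL hN e η]
  have hosc : ∀ (ζ : GaugeConfig d L (SUN N)) (g g' : SUN N),
      localTilt W e ζ g ≤ localTilt W e ζ g' + w.oscLoad 0 e := fun ζ g g' => by
    have := localTilt_sub_le_oscLoad w e ζ g g'
    linarith
  obtain ⟨lo, hwinω⟩ := exists_window_of_osc (1 : SUN N) (hosc ω)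
  obtain ⟨lo', hwinη⟩ := exists_window_of_osc (1 : SUN N) (hosc η)
  have hr0 : 0 ≤ suFrobDist (ω y) (η y) := suFrobDist_nonneg _ _
  have hD : 0 ≤ w.crossLip 0 e y * suFrobDist (ω y) (η y) := mul_nonneg (crossLip_nonneg w 0 e y) hr0
  have hcross : ∀ g, |localTilt W e ω g - localTilt W e η g| ≤ w.crossLip 0 e y * suFrobDist (ω y) (η y) :=
    fun g => abs_localTilt_sub_localTilt_le_crossLip w hye hωη g
  have hBω : matrixOpNorm (tField β e ω) ≤ b := (matrixOpNorm_tField_le hd hN β e ω).trans hb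
  have hBη : matrixOpNorm (tField β e η) ≤ b := (matrixOpNorm_tField_le hd hN β e η).trans hb
  have hΔB : frobNorm (tField β e ω - tField β e η) ≤ |β| / N * tInfluence e y * suFrobDist (ω y) (η y) :=
    frobNorm_tField_sub_le hL β e y hωη
  have key := abs_integral_perturbedOneLink_sub_le (N := N) hc hv hD hLφ hP hVB hBη hBω
    (measurable_localTilt W e η) (measurable_localTilt W e ω) hwinη hwinω hcross hφm hφb hφL
  refine key.trans ?_
  have h1 : Real.exp (w.oscLoad 0 e) * Real.sqrt (c * v) * frobNorm (tField β e ω - tField β e η) ≤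
      Real.exp (w.oscLoad 0 e) * Real.sqrt (c * v) * (|β| / N * tInfluence e y * suFrobDist (ω y) (η y)) :=
    mul_le_mul_of_nonneg_left hΔB (by positivity)
  calc Lφ * (Real.exp (w.oscLoad 0 e) * Real.sqrt (c * v) * frobNorm (tField β e ω - tField β e η) +
        Real.exp (w.oscLoad 0 e / 2) * Real.sqrt c * (w.crossLip 0 e y * suFrobDist (ω y) (η y)))
      ≤ Lφ * (Real.exp (w.oscLoad 0 e) * Real.sqrt (c * v) * (|β| / N * tInfluence e y * suFrobDist (ω y) (η y)) +
        Real.exp (w.oscLoad 0 e / 2) * Real.sqrt c * (w.crossLip 0 e y * suFrobDist (ω y) (η y))) :=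
        mul_le_mul_of_nonneg_left (add_le_add h1 le_rfl) hLφ
    _ = _ := by ring

end Entry

/-! ### Dobrushin's condition and the row sums, variance form -/

section Door

variable {W : Perturbation d L N}

/-- The variance-form entries are nonnegative. [folklore] -/
theorem varianceEntry_nonneg (β c v : ℝ) (w : LoadWitness W) (e y : Edge d L) :
    0 ≤ Real.exp (w.oscLoad 0 e) * Real.sqrt (c * v) * (|β| / N) * tInfluence e y +
        Real.exp (w.oscLoad 0 e / 2) * Real.sqrt c * w.crossLip 0 e y :=
  add_nonneg (by positivity) (mul_nonneg (by positivity) (crossLip_nonneg w 0 e y))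

/-- **Dobrushin's condition (Vasserstein form), variance route, all links as neighbours.** [folklore] -/
theorem isKRContraction_perturbedTorusSpec_variance (hd : 1 ≤ d) (hN : 1 ≤ N) (hL : 1 < L) {β b c v : ℝ}
    (hc : 0 ≤ c) (hv : 0 ≤ v) (hb : |β| / N * (2 * ((d : ℝ) - 1)) ≤ b) (hP : OneLinkPoincareSUN N b c)
    (hVB : OneLinkVarianceBound N b v) (w : LoadWitness W) :
    IsKRContraction (perturbedTorusSpec W β) suFrobDist (fun e => univ.erase e) fun e y =>
      Real.exp (w.oscLoad 0 e) * Real.sqrt (c * v) * (|β| / N) * tInfluence e y +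
        Real.exp (w.oscLoad 0 e / 2) * Real.sqrt c * w.crossLip 0 e y := by
  refine ⟨fun e => Finset.notMem_erase e _, fun e y => varianceEntry_nonneg β c v w e y,
    fun e η η' h => siteLaw_perturbedTorusSpec_congr_off β e fun z hz =>
      h z (Finset.mem_erase.2 ⟨hz, Finset.mem_univ _⟩),
    fun e y hy ω η hωη φ L' hφm hφb hL' hφL => ?_⟩
  exact abs_integral_siteLaw_sub_le_variance hd hN hL hc hv hb hP hVB w (Finset.mem_erase.1 hy).1 hωη φ L' hφm
    hφb hL' hφL

/-- **Dobrushin's condition, variance route, neighbourhoods of range `r ⊔ 1`** (tier-1 members). [folklore] -/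
theorem isKRContraction_perturbedTorusSpec_variance_of_hasRange (hd : 1 ≤ d) (hN : 1 ≤ N) (hL : 1 < L)
    {β b c v : ℝ} (hc : 0 ≤ c) (hv : 0 ≤ v) (hb : |β| / N * (2 * ((d : ℝ) - 1)) ≤ b) (hP : OneLinkPoincareSUN N b c)
    (hVB : OneLinkVarianceBound N b v) (w : LoadWitness W) {r : ℕ} (hr : HasRange r W) :
    IsKRContraction (perturbedTorusSpec W β) suFrobDist
      (fun e => (univ.erase e).filter fun y => torusNorm (e.1 - y.1) ≤ max r 1) fun e y =>
      Real.exp (w.oscLoad 0 e) * Real.sqrt (c * v) * (|β| / N) * tInfluence e y +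
        Real.exp (w.oscLoad 0 e / 2) * Real.sqrt c * w.crossLip 0 e y := by
  refine ⟨fun e h => Finset.notMem_erase e _ (Finset.mem_filter.1 h).1, fun e y => varianceEntry_nonneg β c v w e y,
    fun e η η' h => siteLaw_perturbedTorusSpec_congr_of_hasRange β hr e h,
    fun e y hy ω η hωη φ L' hφm hφb hL' hφL => ?_⟩
  exact abs_integral_siteLaw_sub_le_variance hd hN hL hc hv hb hP hVB w
    (Finset.mem_erase.1 (Finset.mem_filter.1 hy).1).1 hωη φ L' hφm hφb hL' hφL

/-- **Row sum, variance form**: `∑_{y ≠ e} C_V(e,y) ≤ e^{a(e)} √(cv) (|β|/N) 6(d−1) + e^{a(e)/2} √c Λ(e)`. [folklore] -/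
theorem sum_erase_varianceEntry_le (hd : 1 ≤ d) (hL : 1 < L) (β c v : ℝ) (w : LoadWitness W) (e : Edge d L) :
    ∑ y ∈ univ.erase e, (Real.exp (w.oscLoad 0 e) * Real.sqrt (c * v) * (|β| / N) * tInfluence e y +
        Real.exp (w.oscLoad 0 e / 2) * Real.sqrt c * w.crossLip 0 e y) ≤
      Real.exp (w.oscLoad 0 e) * Real.sqrt (c * v) * (|β| / N) * (6 * ((d : ℝ) - 1)) +
        Real.exp (w.oscLoad 0 e / 2) * Real.sqrt c * w.crossLipLoad 0 e := by
  rw [Finset.sum_add_distrib, ← Finset.mul_sum, ← Finset.mul_sum]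
  exact add_le_add (mul_le_mul_of_nonneg_left (sum_erase_tInfluence_le hd hL e) (by positivity)) le_rfl

/-- **Weighted row sum, variance form** (`t ≥ 0`):
`∑_{y ≠ e} C_V(e,y) e^{t‖e−y‖_∞} ≤ e^{t} e^{a(e)} √(cv) (|β|/N) 6(d−1) + e^{a(e)/2} √c Λ_t(e)`. [folklore] -/
theorem sum_erase_varianceEntry_mul_exp_le (hd : 1 ≤ d) (hL : 1 < L) (β c v : ℝ) (w : LoadWitness W) {t : ℝ}
    (ht : 0 ≤ t) (e : Edge d L) :
    ∑ y ∈ univ.erase e, (Real.exp (w.oscLoad 0 e) * Real.sqrt (c * v) * (|β| / N) * tInfluence e y +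
        Real.exp (w.oscLoad 0 e / 2) * Real.sqrt c * w.crossLip 0 e y) * Real.exp (t * torusNorm (e.1 - y.1)) ≤
      Real.exp t * Real.exp (w.oscLoad 0 e) * Real.sqrt (c * v) * (|β| / N) * (6 * ((d : ℝ) - 1)) +
        Real.exp (w.oscLoad 0 e / 2) * Real.sqrt c * w.crossLipLoad t e := by
  have hsplit : ∀ y ∈ univ.erase e,
      (Real.exp (w.oscLoad 0 e) * Real.sqrt (c * v) * (|β| / N) * tInfluence e y +
          Real.exp (w.oscLoad 0 e / 2) * Real.sqrt c * w.crossLip 0 e y) * Real.exp (t * torusNorm (e.1 - y.1)) =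
        Real.exp (w.oscLoad 0 e) * Real.sqrt (c * v) * (|β| / N) *
            ((tInfluence e y : ℝ) * Real.exp (t * torusNorm (e.1 - y.1))) +
          Real.exp (w.oscLoad 0 e / 2) * Real.sqrt c * (w.crossLip 0 e y * Real.exp (t * torusNorm (e.1 - y.1))) :=
    fun y _ => by ring
  rw [Finset.sum_congr rfl hsplit, Finset.sum_add_distrib, ← Finset.mul_sum, ← Finset.mul_sum]
  refine add_le_add ?_ (mul_le_mul_of_nonneg_left (sum_erase_crossLip_mul_exp_le w ht e) (by positivity))
  calc Real.exp (w.oscLoad 0 e) * Real.sqrt (c * v) * (|β| / N) *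
          ∑ y ∈ univ.erase e, (tInfluence e y : ℝ) * Real.exp (t * torusNorm (e.1 - y.1))
      ≤ Real.exp (w.oscLoad 0 e) * Real.sqrt (c * v) * (|β| / N) * (Real.exp t * (6 * ((d : ℝ) - 1))) :=
        mul_le_mul_of_nonneg_left (sum_erase_tInfluence_mul_exp_le hd hL ht e) (by positivity)
    _ = _ := by ring

/-- **The robust torus door, variance route (tier 1)**: a Poincaré / variance pair `(c, v)` on the radius
`b ≥ (|β|/N) 2(d−1)` gives `RobustTorusDoor N d β ε₀ ε₁ r (e^{ε₀} √(cv) (|β|/N) 6(d−1) + e^{ε₀/2} √c ε₁)` — no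
self-Lipschitz factor (`d, N ≥ 1`). [folklore] -/
theorem robustTorusDoor_of_poincare_of_varianceBound (hd : 1 ≤ d) (hN : 1 ≤ N) {β b c v ε₀ ε₁ : ℝ} (hc : 0 ≤ c)
    (hv : 0 ≤ v) (hb : |β| / N * (2 * ((d : ℝ) - 1)) ≤ b) (hP : OneLinkPoincareSUN N b c)
    (hVB : OneLinkVarianceBound N b v) (r : ℕ) :
    RobustTorusDoor N d β ε₀ ε₁ r
      (Real.exp ε₀ * Real.sqrt (c * v) * (|β| / N) * (6 * ((d : ℝ) - 1)) + Real.exp (ε₀ / 2) * Real.sqrt c * ε₁) := by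
  intro L _ hL W hW
  obtain ⟨hr, w, hwa, hwℓ⟩ := exists_witness_of_mem_clusterDomainFR hW
  have hL1 : 1 < L := by omega
  have hd1 : (0 : ℝ) ≤ (d : ℝ) - 1 := by
    have : (1 : ℝ) ≤ d := by exact_mod_cast hd
    linarith
  refine ⟨fun e => (univ.erase e).filter fun y => torusNorm (e.1 - y.1) ≤ max r 1, _,
    isKRContraction_perturbedTorusSpec_variance_of_hasRange hd hN hL1 hc hv hb hP hVB w hr, fun e => ?_,
    fun e y hy => (Finset.mem_filter.1 hy).2⟩
  refine le_trans (Finset.sum_le_sum_of_subset_of_nonneg (Finset.filter_subset _ _)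
    fun y _ _ => varianceEntry_nonneg β c v w e y) ?_
  refine (sum_erase_varianceEntry_le hd hL1 β c v w e).trans ?_
  have hΛ : w.crossLipLoad 0 e ≤ ε₁ := le_trans (le_add_of_nonneg_left (selfLipLoad_nonneg w 0 e)) (hwℓ e)
  have hea : Real.exp (w.oscLoad 0 e) ≤ Real.exp ε₀ := Real.exp_le_exp.2 (hwa e)
  have hea2 : Real.exp (w.oscLoad 0 e / 2) ≤ Real.exp (ε₀ / 2) := Real.exp_le_exp.2 (by linarith [hwa e])
  exact add_le_add (mul_le_mul_of_nonneg_right (mul_le_mul_of_nonneg_right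
      (mul_le_mul_of_nonneg_right hea (Real.sqrt_nonneg _)) (by positivity)) (by positivity))
    (mul_le_mul (mul_le_mul_of_nonneg_right hea2 (Real.sqrt_nonneg _)) hΛ (crossLipLoad_nonneg w 0 e)
      (by positivity))

/-- **The robust torus door, variance route (tier 2, weighted rows)** for `κ ≥ 0`:
`RobustTorusDoorW N d β κ ε₀ ε₁ κ (e^{κ} e^{ε₀} √(cv) (|β|/N) 6(d−1) + e^{ε₀/2} √c ε₁)`. [folklore] -/
theorem robustTorusDoorW_of_poincare_of_varianceBound (hd : 1 ≤ d) (hN : 1 ≤ N) {β κ b c v ε₀ ε₁ : ℝ}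
    (hκ : 0 ≤ κ) (hc : 0 ≤ c) (hv : 0 ≤ v) (hb : |β| / N * (2 * ((d : ℝ) - 1)) ≤ b) (hP : OneLinkPoincareSUN N b c)
    (hVB : OneLinkVarianceBound N b v) :
    RobustTorusDoorW N d β κ ε₀ ε₁ κ
      (Real.exp κ * Real.exp ε₀ * Real.sqrt (c * v) * (|β| / N) * (6 * ((d : ℝ) - 1)) +
        Real.exp (ε₀ / 2) * Real.sqrt c * ε₁) := by
  intro L _ hL W hW
  obtain ⟨w, hwa, hwℓ⟩ := exists_witness_of_mem_clusterDomain hW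
  have hL1 : 1 < L := by omega
  have hd1 : (0 : ℝ) ≤ (d : ℝ) - 1 := by
    have : (1 : ℝ) ≤ d := by exact_mod_cast hd
    linarith
  refine ⟨fun e => univ.erase e, _, isKRContraction_perturbedTorusSpec_variance hd hN hL1 hc hv hb hP hVB w,
    fun e => ?_⟩
  refine (sum_erase_varianceEntry_mul_exp_le hd hL1 β c v w hκ e).trans ?_
  have ha : w.oscLoad 0 e ≤ ε₀ := (oscLoad_zero_le w hκ e).trans (hwa e)
  have hΛ : w.crossLipLoad κ e ≤ ε₁ := le_trans (le_add_of_nonneg_left (selfLipLoad_nonneg w κ e)) (hwℓ e)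
  have hea : Real.exp (w.oscLoad 0 e) ≤ Real.exp ε₀ := Real.exp_le_exp.2 ha
  have hea2 : Real.exp (w.oscLoad 0 e / 2) ≤ Real.exp (ε₀ / 2) := Real.exp_le_exp.2 (by linarith)
  exact add_le_add (mul_le_mul_of_nonneg_right (mul_le_mul_of_nonneg_right (mul_le_mul_of_nonneg_right
      (mul_le_mul_of_nonneg_left hea (Real.exp_pos _).le) (Real.sqrt_nonneg _)) (by positivity)) (by positivity))
    (mul_le_mul (mul_le_mul_of_nonneg_right hea2 (Real.sqrt_nonneg _)) hΛ (crossLipLoad_nonneg w κ e)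
      (by positivity))

/-- **Torus clustering on the tier-1 ball, variance route**: with
`ρ_V = e^{ε₀} √(cv) (|β|/N) 6(d−1) + e^{ε₀/2} √c ε₁ ∈ (0, 1)`, constant `8N`, rate `−log ρ_V/(r ⊔ 1)`. [folklore] -/
theorem torusClusteringOnBall_of_poincare_of_varianceBound (hd : 1 ≤ d) (hN : 1 ≤ N) {β b c v ε₀ ε₁ : ℝ}
    (hc : 0 ≤ c) (hv : 0 ≤ v) (hb : |β| / N * (2 * ((d : ℝ) - 1)) ≤ b) (hP : OneLinkPoincareSUN N b c)
    (hVB : OneLinkVarianceBound N b v) (r : ℕ)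
    (hρ0 : 0 < Real.exp ε₀ * Real.sqrt (c * v) * (|β| / N) * (6 * ((d : ℝ) - 1)) + Real.exp (ε₀ / 2) * Real.sqrt c * ε₁)
    (hρ1 : Real.exp ε₀ * Real.sqrt (c * v) * (|β| / N) * (6 * ((d : ℝ) - 1)) + Real.exp (ε₀ / 2) * Real.sqrt c * ε₁ < 1) :
    TorusClusteringOnBall N d β ε₀ ε₁ r (8 * N)
      (-Real.log (Real.exp ε₀ * Real.sqrt (c * v) * (|β| / N) * (6 * ((d : ℝ) - 1)) +
          Real.exp (ε₀ / 2) * Real.sqrt c * ε₁) / max r 1) :=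
  clusteringFromDoorTarget_holds N d β ε₀ ε₁ _ r
    (robustTorusDoor_of_poincare_of_varianceBound hd hN hc hv hb hP hVB r) hρ0 hρ1

/-- **Torus clustering on the tier-2 ball, variance route** (`κ ≥ 0`): rate `κ`, constant `8N`, whenever
`e^{κ} e^{ε₀} √(cv) (|β|/N) 6(d−1) + e^{ε₀/2} √c ε₁ < 1`. [folklore] -/
theorem torusClusteringOnBallW_of_poincare_of_varianceBound (hd : 1 ≤ d) (hN : 1 ≤ N) {β κ b c v ε₀ ε₁ : ℝ}
    (hκ : 0 ≤ κ) (hc : 0 ≤ c) (hv : 0 ≤ v) (hb : |β| / N * (2 * ((d : ℝ) - 1)) ≤ b) (hP : OneLinkPoincareSUN N b c)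
    (hVB : OneLinkVarianceBound N b v) (hε₁ : 0 ≤ ε₁)
    (hρ1 : Real.exp κ * Real.exp ε₀ * Real.sqrt (c * v) * (|β| / N) * (6 * ((d : ℝ) - 1)) +
        Real.exp (ε₀ / 2) * Real.sqrt c * ε₁ < 1) :
    TorusClusteringOnBallW N d β κ ε₀ ε₁ (8 * N) κ := by
  have hd1 : (0 : ℝ) ≤ (d : ℝ) - 1 := by
    have : (1 : ℝ) ≤ d := by exact_mod_cast hd
    linarith
  exact clusteringFromWeightedDoorTarget_holds N d β κ ε₀ ε₁ κ _
    (robustTorusDoorW_of_poincare_of_varianceBound hd hN hκ hc hv hb hP hVB) hκ (by positivity) hρ1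

end Door

end Summit.Ventures.YMGap.RobustBall

end
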